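import Literature.Probability.RandomMatrix.ComplexGaussianVector
import Literature.MathematicalPhysics.QuantumFieldTheory.StrongCouplingActivities
import Literature.MeasureTheory.TotalVariation.SetwiseBound
import HarnessLib

/-!
# Polar factorisation of unitarily invariant laws on `ℂⁿ`

Let `μ` be a probability measure on `ℂⁿ` (`Fin n → ℂ`) invariant under `x ↦ Ux` for every unitary
matrix `U ∈ U(n)`. Then `μ` is the image of `Haar_{U(n)} ⊗ Law_μ(‖x‖²)` under
`(U, t) ↦ U(√t · v₀)` for any fixed unit vector `v₀` (`eq_map_haar_prod_map_vecNormSq`): a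
`μ`-distributed vector is a Haar-random rotation of `√R · v₀` with `R ∼ Law_μ(‖x‖²)` independent.
The proof is the standard averaging argument (`μ = ∫ U_*μ dU`, Fubini, transitivity of `U(n)` on
spheres and right invariance of the Haar measure of the compact group `U(n)`); no density or
disintegration is used.

Consequence (`tvClose_of_unitaryInvariant`): two unitarily invariant probability measures on
`ℂⁿ` are as close in total variation as the laws of `‖x‖²` under them — the reduction of
rotation-invariant comparisons to radial ones used for truncations of uniform points on spheres.

## References

* M. L. Eaton, *Group invariance applications in statistics*, IMS 1989, Ch. 2–4 (invariant
  measures on homogeneous spaces; uniqueness by averaging), Example 4.3 (polar decomposition of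
  orthogonally invariant laws).
-/

open MeasureTheory ProbabilityTheory WithLp Matrix
open scoped ENNReal NNReal

namespace Literature.Probability.RandomMatrix

open Literature.MeasureTheory.TotalVariation
open Literature.MathematicalPhysics.QuantumFieldTheory (haarProbability)

variable {n : ℕ}

/-- The squared Euclidean norm `‖x‖² = ∑ᵢ |xᵢ|²` on `Fin n → ℂ`. [folklore] -/
noncomputable def vecNormSq (x : Fin n → ℂ) : ℝ := ∑ i, ‖x i‖ ^ 2

/-- `vecNormSq` is continuous. [folklore] -/
theorem continuous_vecNormSq : Continuous (vecNormSq (n := n)) := by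
  unfold vecNormSq; fun_prop

/-- `vecNormSq` is measurable. [folklore] -/
theorem measurable_vecNormSq : Measurable (vecNormSq (n := n)) := continuous_vecNormSq.measurable

/-- `vecNormSq ≥ 0`. [folklore] -/
theorem vecNormSq_nonneg (x : Fin n → ℂ) : 0 ≤ vecNormSq x :=
  Finset.sum_nonneg fun i _ => by positivity

/-- `vecNormSq x = ‖toLp 2 x‖²` (the Euclidean norm). [folklore] -/
theorem vecNormSq_eq_norm_sq (x : Fin n → ℂ) : vecNormSq x = ‖(toLp 2 x : EuclideanSpace ℂ (Fin n))‖ ^ 2 := by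
  rw [EuclideanSpace.norm_sq_eq]; rfl

/-- Unitary matrices preserve `vecNormSq`. [folklore] -/
theorem vecNormSq_unitary_mulVec (U : Matrix.unitaryGroup (Fin n) ℂ) (x : Fin n → ℂ) :
    vecNormSq ((U : Matrix (Fin n) (Fin n) ℂ) *ᵥ x) = vecNormSq x := by
  rw [vecNormSq_eq_norm_sq, vecNormSq_eq_norm_sq, ← unitaryEuclidean_apply U (toLp 2 x),
    LinearIsometryEquiv.norm_map]

/-- Scaling: `vecNormSq (c • x) = |c|² vecNormSq x` for real `c`. [folklore] -/
theorem vecNormSq_real_smul (c : ℝ) (x : Fin n → ℂ) : vecNormSq ((c : ℂ) • x) = c ^ 2 * vecNormSq x := by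
  unfold vecNormSq
  rw [Finset.mul_sum]
  refine Finset.sum_congr rfl fun i _ => ?_
  rw [Pi.smul_apply, smul_eq_mul, norm_mul, mul_pow, Complex.norm_real, Real.norm_eq_abs, sq_abs]

/-! ### Transitivity of `U(n)` on spheres -/

/-- The unitary matrix whose columns are the vectors of an orthonormal basis of `ℂⁿ`.
[folklore] -/
noncomputable def unitaryOfOrthonormalBasis (B : OrthonormalBasis (Fin n) ℂ (EuclideanSpace ℂ (Fin n))) :
    Matrix.unitaryGroup (Fin n) ℂ :=
  ⟨(EuclideanSpace.basisFun (Fin n) ℂ).toBasis.toMatrix B.toBasis,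
    (EuclideanSpace.basisFun (Fin n) ℂ).toMatrix_orthonormalBasis_mem_unitary B⟩

/-- The `j`-th column of `unitaryOfOrthonormalBasis B` is `B j`. [folklore] -/
theorem unitaryOfOrthonormalBasis_mulVec_single (B : OrthonormalBasis (Fin n) ℂ (EuclideanSpace ℂ (Fin n)))
    (j : Fin n) :
    (unitaryOfOrthonormalBasis B : Matrix (Fin n) (Fin n) ℂ) *ᵥ Pi.single j 1 = ⇑(B j) := by
  rw [mulVec_single_one]
  rfl

/-- `(unitaryOfOrthonormalBasis B)† (B j) = e_j`. [folklore] -/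
theorem star_unitaryOfOrthonormalBasis_mulVec (B : OrthonormalBasis (Fin n) ℂ (EuclideanSpace ℂ (Fin n)))
    (j : Fin n) :
    (star (unitaryOfOrthonormalBasis B : Matrix (Fin n) (Fin n) ℂ)) *ᵥ ⇑(B j) = Pi.single j 1 := by
  rw [← unitaryOfOrthonormalBasis_mulVec_single, mulVec_mulVec, Unitary.coe_star_mul_self,
    one_mulVec]

/-- **`U(n)` is transitive on unit vectors**: for unit vectors `v, w` (`‖v‖ = ‖w‖ = 1` in `ℂⁿ`)
there is a unitary matrix `U` with `U v = w`. [folklore] -/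
theorem exists_unitary_mulVec_eq {v w : Fin n → ℂ} (hv : vecNormSq v = 1) (hw : vecNormSq w = 1) :
    ∃ U : Matrix.unitaryGroup (Fin n) ℂ, (U : Matrix (Fin n) (Fin n) ℂ) *ᵥ v = w := by
  rcases Nat.eq_zero_or_pos n with hn | hn
  · subst hn
    refine ⟨1, ?_⟩
    funext i; exact Fin.elim0 i
  · set i₀ : Fin n := ⟨0, hn⟩
    -- extend `v` and `w` to orthonormal bases with index `i₀`
    have hv1 : ‖(toLp 2 v : EuclideanSpace ℂ (Fin n))‖ = 1 := by
      refine (pow_eq_one_iff_of_nonneg (norm_nonneg _) two_ne_zero).1 ?_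
      rw [← vecNormSq_eq_norm_sq, hv]
    have hw1 : ‖(toLp 2 w : EuclideanSpace ℂ (Fin n))‖ = 1 := by
      refine (pow_eq_one_iff_of_nonneg (norm_nonneg _) two_ne_zero).1 ?_
      rw [← vecNormSq_eq_norm_sq, hw]
    have hcard : Module.finrank ℂ (EuclideanSpace ℂ (Fin n)) = Fintype.card (Fin n) := by
      simp
    have hov : Orthonormal ℂ (({i₀} : Set (Fin n)).restrict fun _ : Fin n =>
        (toLp 2 v : EuclideanSpace ℂ (Fin n))) :=
      ⟨fun _ => hv1, fun i j hij => absurd (Subsingleton.elim i j) hij⟩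
    have how : Orthonormal ℂ (({i₀} : Set (Fin n)).restrict fun _ : Fin n =>
        (toLp 2 w : EuclideanSpace ℂ (Fin n))) :=
      ⟨fun _ => hw1, fun i j hij => absurd (Subsingleton.elim i j) hij⟩
    obtain ⟨Bv, hBv⟩ := Orthonormal.exists_orthonormalBasis_extension_of_card_eq hcard hov
    obtain ⟨Bw, hBw⟩ := Orthonormal.exists_orthonormalBasis_extension_of_card_eq hcard how
    have hBv0 : ⇑(Bv i₀) = v := by
      have := hBv i₀ (Set.mem_singleton i₀); rw [this]
    have hBw0 : ⇑(Bw i₀) = w := by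
      have := hBw i₀ (Set.mem_singleton i₀); rw [this]
    refine ⟨unitaryOfOrthonormalBasis Bw * star (unitaryOfOrthonormalBasis Bv), ?_⟩
    rw [Matrix.UnitaryGroup.mul_val]
    change ((unitaryOfOrthonormalBasis Bw : Matrix (Fin n) (Fin n) ℂ) *
      star (unitaryOfOrthonormalBasis Bv : Matrix (Fin n) (Fin n) ℂ)) *ᵥ v = w
    rw [← mulVec_mulVec, ← hBv0, star_unitaryOfOrthonormalBasis_mulVec,
      unitaryOfOrthonormalBasis_mulVec_single, hBw0]

/-! ### The polar factorisation -/

section Polar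

variable (n)

/-- The "polar" map `(U, t) ↦ U (√t · v₀)`. [folklore] -/
noncomputable def polarMap (v₀ : Fin n → ℂ) (p : Matrix.unitaryGroup (Fin n) ℂ × ℝ) : Fin n → ℂ :=
  (p.1 : Matrix (Fin n) (Fin n) ℂ) *ᵥ ((Real.sqrt p.2 : ℂ) • v₀)

variable {n}

/-- Joint continuity of the action `(U, x) ↦ U x`. [folklore] -/
theorem continuous_unitary_mulVec :
    Continuous fun p : Matrix.unitaryGroup (Fin n) ℂ × (Fin n → ℂ) =>
      (p.1 : Matrix (Fin n) (Fin n) ℂ) *ᵥ p.2 := by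
  have hA : Continuous fun p : Matrix.unitaryGroup (Fin n) ℂ × (Fin n → ℂ) =>
      (p.1 : Matrix (Fin n) (Fin n) ℂ) := continuous_subtype_val.comp continuous_fst
  exact hA.matrix_mulVec continuous_snd

/-- The polar map is continuous. [folklore] -/
theorem continuous_polarMap (v₀ : Fin n → ℂ) : Continuous (polarMap n v₀) := by
  unfold polarMap
  have hA : Continuous fun p : Matrix.unitaryGroup (Fin n) ℂ × ℝ =>
      (p.1 : Matrix (Fin n) (Fin n) ℂ) := continuous_subtype_val.comp continuous_fst
  have hc : Continuous fun p : Matrix.unitaryGroup (Fin n) ℂ × ℝ => ((Real.sqrt p.2 : ℝ) : ℂ) :=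
    Complex.continuous_ofReal.comp (Real.continuous_sqrt.comp continuous_snd)
  exact hA.matrix_mulVec (hc.smul continuous_const)

/-- The polar map is measurable. [folklore] -/
theorem measurable_polarMap (v₀ : Fin n → ℂ) : Measurable (polarMap n v₀) :=
  (continuous_polarMap v₀).measurable

/-- **Polar factorisation of a unitarily invariant law.** If the probability measure `μ` on `ℂⁿ`
is invariant under every unitary matrix, then for any unit vector `v₀`,
`μ = (Haar_{U(n)} ⊗ Law_μ(‖x‖²)) ∘ ((U,t) ↦ U(√t v₀))⁻¹`. [folklore] -/
theorem eq_map_haar_prod_map_vecNormSq (μ : Measure (Fin n → ℂ)) [IsProbabilityMeasure μ]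
    (hμ : ∀ U : Matrix.unitaryGroup (Fin n) ℂ, μ.map (fun x => (U : Matrix (Fin n) (Fin n) ℂ) *ᵥ x) = μ)
    {v₀ : Fin n → ℂ} (hv₀ : vecNormSq v₀ = 1) :
    μ = ((haarProbability (Matrix.unitaryGroup (Fin n) ℂ)).prod (μ.map vecNormSq)).map (polarMap n v₀) := by
  set η := haarProbability (Matrix.unitaryGroup (Fin n) ℂ) with hη
  haveI : IsProbabilityMeasure (μ.map (vecNormSq (n := n))) :=
    Measure.isProbabilityMeasure_map measurable_vecNormSq.aemeasurable
  ext E hE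
  rw [Measure.map_apply (measurable_polarMap v₀) hE, Measure.prod_apply_symm
    ((measurable_polarMap v₀) hE), lintegral_map ?_ measurable_vecNormSq]
  swap
  · exact measurable_measure_prodMk_right ((measurable_polarMap v₀) hE)
  -- for each `x`, the fibre has the Haar measure of `{W | W x ∈ E}`
  have hfib : ∀ x : Fin n → ℂ,
      η ((fun U => (U, vecNormSq x)) ⁻¹' ((polarMap n v₀) ⁻¹' E)) =
        η {W : Matrix.unitaryGroup (Fin n) ℂ | (W : Matrix (Fin n) (Fin n) ℂ) *ᵥ x ∈ E} := by
    intro x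
    -- a unitary `Ux` with `Ux (√‖x‖² v₀) = x`
    obtain ⟨Ux, hUx⟩ : ∃ Ux : Matrix.unitaryGroup (Fin n) ℂ,
        (Ux : Matrix (Fin n) (Fin n) ℂ) *ᵥ ((Real.sqrt (vecNormSq x) : ℂ) • v₀) = x := by
      by_cases hx : vecNormSq x = 0
      · refine ⟨1, ?_⟩
        have hx0 : x = 0 := by
          funext i
          have := (Finset.sum_eq_zero_iff_of_nonneg (fun j _ => by positivity)).1 hx i
            (Finset.mem_univ i)
          simpa using this
        rw [hx, Real.sqrt_zero]; simp [hx0]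
      · have hpos : 0 < vecNormSq x := lt_of_le_of_ne (vecNormSq_nonneg x) (Ne.symm hx)
        set c := Real.sqrt (vecNormSq x) with hc
        have hcpos : 0 < c := Real.sqrt_pos.2 hpos
        have hu : vecNormSq ((c⁻¹ : ℂ) • x) = 1 := by
          have : ((c⁻¹ : ℝ) : ℂ) = (c : ℂ)⁻¹ := by push_cast; rfl
          rw [← this, vecNormSq_real_smul, inv_pow, Real.sq_sqrt hpos.le, inv_mul_cancel₀ hx]
        obtain ⟨U, hU⟩ := exists_unitary_mulVec_eq hv₀ hu
        refine ⟨U, ?_⟩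
        rw [mulVec_smul, hU, smul_smul, mul_inv_cancel₀ (by exact_mod_cast hcpos.ne'), one_smul]
    have hset : (fun U => (U, vecNormSq x)) ⁻¹' ((polarMap n v₀) ⁻¹' E) =
        (fun U => U * Ux⁻¹) ⁻¹' {W : Matrix.unitaryGroup (Fin n) ℂ | (W : Matrix (Fin n) (Fin n) ℂ) *ᵥ x ∈ E} := by
      ext U
      simp only [Set.mem_preimage, polarMap, Set.mem_setOf_eq]
      rw [Matrix.UnitaryGroup.mul_val, ← mulVec_mulVec]
      conv_rhs => rw [← hUx]
      rw [mulVec_mulVec, mulVec_mulVec, mul_assoc, Matrix.UnitaryGroup.inv_val,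
        Unitary.coe_star_mul_self, mul_one]
    rw [hset]
    have hmeas : MeasurableSet {W : Matrix.unitaryGroup (Fin n) ℂ | (W : Matrix (Fin n) (Fin n) ℂ) *ᵥ x ∈ E} :=
      (continuous_unitary_mulVec.comp (Continuous.prodMk continuous_id continuous_const)).measurable hE
    rw [← Measure.map_apply (measurable_mul_const _) hmeas, map_mul_right_eq_self η Ux⁻¹]
  simp_rw [hfib]
  have hmeasW : ∀ W : Matrix.unitaryGroup (Fin n) ℂ,
      Measurable fun x : Fin n → ℂ => (W : Matrix (Fin n) (Fin n) ℂ) *ᵥ x :=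
    fun W => (Matrix.mulVecLin (W : Matrix (Fin n) (Fin n) ℂ)).continuous_of_finiteDimensional.measurable
  have hS' : MeasurableSet {p : Matrix.unitaryGroup (Fin n) ℂ × (Fin n → ℂ) |
      (p.1 : Matrix (Fin n) (Fin n) ℂ) *ᵥ p.2 ∈ E} :=
    continuous_unitary_mulVec.measurable hE
  have h1 : ∫⁻ x, η {W : Matrix.unitaryGroup (Fin n) ℂ | (W : Matrix (Fin n) (Fin n) ℂ) *ᵥ x ∈ E} ∂μ =
      (η.prod μ) {p | (p.1 : Matrix (Fin n) (Fin n) ℂ) *ᵥ p.2 ∈ E} := by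
    rw [Measure.prod_apply_symm hS']; rfl
  rw [h1, Measure.prod_apply hS']
  have h2 : ∀ W : Matrix.unitaryGroup (Fin n) ℂ, μ (Prod.mk W ⁻¹' {p : Matrix.unitaryGroup (Fin n) ℂ ×
      (Fin n → ℂ) | (p.1 : Matrix (Fin n) (Fin n) ℂ) *ᵥ p.2 ∈ E}) = μ E := by
    intro W
    have : Prod.mk W ⁻¹' {p : Matrix.unitaryGroup (Fin n) ℂ × (Fin n → ℂ) |
        (p.1 : Matrix (Fin n) (Fin n) ℂ) *ᵥ p.2 ∈ E} =
        (fun x => (W : Matrix (Fin n) (Fin n) ℂ) *ᵥ x) ⁻¹' E := rfl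
    rw [this, ← Measure.map_apply (hmeasW W) hE, hμ W]
  simp_rw [h2]
  rw [lintegral_const, measure_univ, mul_one]

/-- The standard unit vector `e₀` has `vecNormSq = 1`. [folklore] -/
theorem vecNormSq_single {n : ℕ} (i : Fin n) : vecNormSq (Pi.single i (1:ℂ) : Fin n → ℂ) = 1 := by
  unfold vecNormSq
  have : ∀ j : Fin n, ‖(Pi.single i (1:ℂ) : Fin n → ℂ) j‖ ^ 2 = if j = i then 1 else 0 := by
    intro j
    by_cases h : j = i
    · subst h; simp
    · simp [h]
  simp_rw [this]
  simp

/-- **Reduction to radial laws.** Two unitarily invariant probability measures on `ℂⁿ` are as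
close (setwise, in total variation) as the laws of `‖x‖²` under them. [folklore] -/
theorem tvClose_of_unitaryInvariant (μ μ' : Measure (Fin n → ℂ)) [IsProbabilityMeasure μ]
    [IsProbabilityMeasure μ']
    (hμ : ∀ U : Matrix.unitaryGroup (Fin n) ℂ, μ.map (fun x => (U : Matrix (Fin n) (Fin n) ℂ) *ᵥ x) = μ)
    (hμ' : ∀ U : Matrix.unitaryGroup (Fin n) ℂ, μ'.map (fun x => (U : Matrix (Fin n) (Fin n) ℂ) *ᵥ x) = μ')
    {ε : ℝ} (h : TVClose (μ.map vecNormSq) (μ'.map vecNormSq) ε) : TVClose μ μ' ε := by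
  rcases Nat.eq_zero_or_pos n with hn | hn
  · subst hn
    intro E _
    have hε := h.nonneg
    rcases Set.eq_empty_or_nonempty E with hE | hE
    · rw [hE]; simpa using hε
    · rw [Subsingleton.eq_univ_of_nonempty hE]; simpa using hε
  · set v₀ : Fin n → ℂ := Pi.single ⟨0, hn⟩ 1
    have hv₀ : vecNormSq v₀ = 1 := vecNormSq_single _
    haveI : IsProbabilityMeasure (μ.map (vecNormSq (n := n))) :=
      Measure.isProbabilityMeasure_map measurable_vecNormSq.aemeasurable
    haveI : IsProbabilityMeasure (μ'.map (vecNormSq (n := n))) :=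
      Measure.isProbabilityMeasure_map measurable_vecNormSq.aemeasurable
    have key := (h.prod_right_factor (haarProbability (Matrix.unitaryGroup (Fin n) ℂ))).map
      (measurable_polarMap v₀)
    rwa [← eq_map_haar_prod_map_vecNormSq μ hμ hv₀, ← eq_map_haar_prod_map_vecNormSq μ' hμ' hv₀]
      at key

end Polar

end Literature.Probability.RandomMatrix
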